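import Literature.Analysis.FluidPDE.MVRelativeEnergyIntegrands
import Literature.Analysis.FluidPDE.ClassicalEulerTestFunctions
import Literature.Analysis.FluidPDE.YoungMeasureIntegrals
import HarnessLib

/-!
# Continuity and measurability of the relative-energy integrands along a classical solution

For the weak–strong uniqueness argument (Březina–Feireisl 2018, §3) in the kernel framework of
`DissipativeMVEuler.lean` every phase-space integrand `g(z, w)` (`z = (t,x)`, `w = (ρ,E,m)`) must be
jointly measurable after modification off the open quadrant `{ρ, E > 0}` (which carries the
Young measure). We record:

* `IsSmoothSpaceTimeOn.continuousOn_uncurry_Ioo` — fields smooth on `[0,T₁) × 𝕋³` are jointly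
  continuous on `(0,T₁) × 𝕋³` as functions of `(t, x)` (`id × proj` is an open quotient map);
* continuity of the point data `z ↦ classicalPointData … z.1 z.2` (all components) and of the
  derived coefficients (`φ₁t`, `gφ₁`, `pt`, …) on `(0,T₁) × 𝕋³`;
* continuity on the quadrant of the thermodynamic functions of the state
  (`continuousOn_stateTemp`, `continuousOn_statePressure`, `continuousOn_stateEntropy`);
* joint continuity on `((0,T₁) × 𝕋³) × quadrant` of `contI`, `momI`, `entI`, `relEnergyZ`,
  `rawRHS`, `relEnergyFull`, `momentFun`, hence measurability of their modifications
  (`measurable_modify`), and the kernel-integrability wrapper `integrable_avg_of_dominated`.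

## References

* J. Březina, E. Feireisl, J. Math. Soc. Japan 70 (2018), §3.
-/

noncomputable section

open Set Function MeasureTheory ProbabilityTheory Filter
open scoped BigOperators ENNReal Topology

namespace Literature.Analysis.FluidPDE

namespace CompressibleEuler

open Literature.Analysis.FunctionSpaces Literature.Analysis.FunctionSpaces.Torus EulerPhase
  StrongPointData EulerEOS

/-! ## Joint continuity of space–time fields on the open time interval -/

section Descent

variable {F : Type*} [NormedAddCommGroup F] [NormedSpace ℝ F] {d : Type*} [Fintype d]

/-- A field jointly smooth on `[0,T₁) × 𝕋ᵈ` is jointly continuous in `(t, x)` on `(0,T₁) × 𝕋ᵈ`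
(`id × proj : ℝ × ℝᵈ → ℝ × 𝕋ᵈ` is an open quotient map, `IsOpenQuotientMap.continuousAt_comp_iff`).
Declared by its absolute name as a dot-notation extension of `Torus.IsSmoothSpaceTimeOn`
(`FunctionSpaces/TorusSpaceTime.lean`). [folklore] -/
theorem _root_.Literature.Analysis.FunctionSpaces.Torus.IsSmoothSpaceTimeOn.continuousOn_uncurry_Ioo
    {T₁ : ℝ} {G : ℝ → UnitAddTorus d → F}
    (hG : IsSmoothSpaceTimeOn (Ico 0 T₁) G) :
    ContinuousOn (fun z : ℝ × UnitAddTorus d => G z.1 z.2) (Ioo 0 T₁ ×ˢ univ) := by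
  intro z hz
  obtain ⟨t, x⟩ := z
  obtain ⟨y, rfl⟩ := proj_surjective x
  have ht : t ∈ Ioo 0 T₁ := (mem_prod.1 hz).1
  have hq : IsOpenQuotientMap (Prod.map id proj : ℝ × EuclideanSpace ℝ d → ℝ × UnitAddTorus d) :=
    IsOpenQuotientMap.id.prodMap isOpenQuotientMap_proj
  have hat : ContinuousAt (stLift G) (t, y) :=
    (hG.continuousOn_stLift (t, y) ⟨Ioo_subset_Ico_self ht, mem_univ _⟩).continuousAt
      ((isOpen_Ioo.prod isOpen_univ).mem_nhds ⟨ht, mem_univ _⟩ |> Filter.mem_of_superset <|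
        prod_mono Ioo_subset_Ico_self subset_rfl)
  have hcomp : (fun z : ℝ × UnitAddTorus d => G z.1 z.2) ∘ Prod.map id proj = stLift G := by
    funext p; rfl
  have := (hq.continuousAt_comp_iff (g := fun z : ℝ × UnitAddTorus d => G z.1 z.2)
    (x := (t, y))).1 (hcomp ▸ hat)
  exact this.continuousWithinAt

end Descent

/-! ## Thermodynamic functions of the state on the open quadrant -/

section StateFunctions

variable {eos : EulerEOS}

/-- `w ↦ (ρ, E)` maps the open quadrant of the phase space into `(0,∞)²`. [folklore] -/
theorem mapsTo_dens_ien : MapsTo (fun w : EulerPhase => (dens w, ien w)) phaseQuadrant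
    (Ioi 0 ×ˢ Ioi 0) := fun _ hw => ⟨hw.1, hw.2⟩

/-- The density coordinate is continuous. [folklore] -/
theorem continuous_dens : Continuous (dens : EulerPhase → ℝ) := continuous_fst
/-- The internal-energy coordinate is continuous. [folklore] -/
theorem continuous_ien : Continuous (ien : EulerPhase → ℝ) := continuous_fst.comp continuous_snd
/-- The momentum coordinate is continuous. [folklore] -/
theorem continuous_mom : Continuous (mom : EulerPhase → EuclideanSpace ℝ (Fin 3)) :=
  continuous_snd.comp continuous_snd

/-- The temperature of the state is continuous on the open quadrant. [cite: BrezinaFeireisl2018, §2.2] -/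
theorem continuousOn_stateTemp (hG : eos.IsGibbs) (hS : eos.IsThermodynamicallyStable)
    (htemp : ∀ r E : ℝ, 0 < r → 0 < E →
      0 < eos.temperature r E ∧ r * eos.e r (eos.temperature r E) = E) :
    ContinuousOn (fun w : EulerPhase => stateTemp eos (dens w) (ien w)) phaseQuadrant :=
  (continuousOn_temperature hG hS htemp).comp (continuous_dens.prodMk continuous_ien).continuousOn
    mapsTo_dens_ien

/-- `w ↦ (ρ, ϑ(ρ,E))` is continuous on the quadrant into `(0,∞)²`. [folklore] -/
theorem continuousOn_dens_stateTemp (hG : eos.IsGibbs) (hS : eos.IsThermodynamicallyStable)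
    (htemp : ∀ r E : ℝ, 0 < r → 0 < E →
      0 < eos.temperature r E ∧ r * eos.e r (eos.temperature r E) = E) :
    ContinuousOn (fun w : EulerPhase => (dens w, stateTemp eos (dens w) (ien w))) phaseQuadrant ∧
    MapsTo (fun w : EulerPhase => (dens w, stateTemp eos (dens w) (ien w))) phaseQuadrant
      (Ioi 0 ×ˢ Ioi 0) :=
  ⟨continuous_dens.continuousOn.prodMk (continuousOn_stateTemp hG hS htemp),
    fun _ hw => ⟨hw.1, (htemp _ _ hw.1 hw.2).1⟩⟩

/-- The pressure of the state `p(ρ, ϑ(ρ,E))` is continuous on the quadrant. [folklore] -/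
theorem continuousOn_statePressure (hG : eos.IsGibbs) (hS : eos.IsThermodynamicallyStable)
    (htemp : ∀ r E : ℝ, 0 < r → 0 < E →
      0 < eos.temperature r E ∧ r * eos.e r (eos.temperature r E) = E) :
    ContinuousOn (fun w : EulerPhase => eos.p (dens w) (stateTemp eos (dens w) (ien w))) phaseQuadrant :=
  hG.1.continuousOn.comp (continuousOn_dens_stateTemp hG hS htemp).1
    (continuousOn_dens_stateTemp hG hS htemp).2

/-- The entropy of the state `s(ρ, ϑ(ρ,E))` is continuous on the quadrant. [folklore] -/
theorem continuousOn_stateEntropy (hG : eos.IsGibbs) (hS : eos.IsThermodynamicallyStable)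
    (htemp : ∀ r E : ℝ, 0 < r → 0 < E →
      0 < eos.temperature r E ∧ r * eos.e r (eos.temperature r E) = E) :
    ContinuousOn (fun w : EulerPhase => eos.s (dens w) (stateTemp eos (dens w) (ien w))) phaseQuadrant :=
  hG.2.2.1.continuousOn.comp (continuousOn_dens_stateTemp hG hS htemp).1
    (continuousOn_dens_stateTemp hG hS htemp).2

/-- The kinetic energy is continuous on the quadrant. [folklore] -/
theorem continuousOn_kineticEnergy :
    ContinuousOn (EulerPhase.kineticEnergy : EulerPhase → ℝ) phaseQuadrant := by
  unfold EulerPhase.kineticEnergy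
  exact ((continuous_mom.norm.pow 2).continuousOn).div
    ((continuous_const.mul continuous_dens).continuousOn) fun _ hw => by
      have := hw.1; positivity

/-- The moment function is continuous on the quadrant. [folklore] -/
theorem continuousOn_momentFun (hG : eos.IsGibbs) (hS : eos.IsThermodynamicallyStable)
    (htemp : ∀ r E : ℝ, 0 < r → 0 < E →
      0 < eos.temperature r E ∧ r * eos.e r (eos.temperature r E) = E) :
    ContinuousOn (momentFun eos.toConservative) phaseQuadrant := by
  unfold momentFun
  exact (((continuous_dens.continuousOn.add continuous_mom.norm.continuousOn).add
    continuousOn_kineticEnergy).add continuous_ien.continuousOn).add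
    (continuousOn_statePressure hG hS htemp).abs

end StateFunctions

/-! ## Continuity of the point data along a classical solution -/

section PointData

variable {eos : EulerEOS} {T₁ : ℝ} {ρ : ℝ → UnitAddTorus (Fin 3) → ℝ}
  {u : ℝ → UnitAddTorus (Fin 3) → EuclideanSpace ℝ (Fin 3)} {ϑ : ℝ → UnitAddTorus (Fin 3) → ℝ}

/-- The base components of the point data are jointly continuous on `(0,T₁) × 𝕋³`. [folklore] -/
theorem IsClassicalEulerSolution.continuousOn_pointData_base (h : IsClassicalEulerSolution eos T₁ ρ u ϑ) :
    ContinuousOn (fun z : ℝ × UnitAddTorus (Fin 3) => (classicalPointData (Ico 0 T₁) ρ u ϑ z.1 z.2).r)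
        (Ioo 0 T₁ ×ˢ univ) ∧
    ContinuousOn (fun z : ℝ × UnitAddTorus (Fin 3) => (classicalPointData (Ico 0 T₁) ρ u ϑ z.1 z.2).Θ)
        (Ioo 0 T₁ ×ˢ univ) ∧
    ContinuousOn (fun z : ℝ × UnitAddTorus (Fin 3) => (classicalPointData (Ico 0 T₁) ρ u ϑ z.1 z.2).rt)
        (Ioo 0 T₁ ×ˢ univ) ∧
    ContinuousOn (fun z : ℝ × UnitAddTorus (Fin 3) => (classicalPointData (Ico 0 T₁) ρ u ϑ z.1 z.2).Θt)
        (Ioo 0 T₁ ×ˢ univ) ∧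
    (∀ i, ContinuousOn (fun z : ℝ × UnitAddTorus (Fin 3) =>
        (classicalPointData (Ico 0 T₁) ρ u ϑ z.1 z.2).U i) (Ioo 0 T₁ ×ˢ univ)) ∧
    (∀ i, ContinuousOn (fun z : ℝ × UnitAddTorus (Fin 3) =>
        (classicalPointData (Ico 0 T₁) ρ u ϑ z.1 z.2).Ut i) (Ioo 0 T₁ ×ˢ univ)) ∧
    (∀ i, ContinuousOn (fun z : ℝ × UnitAddTorus (Fin 3) =>
        (classicalPointData (Ico 0 T₁) ρ u ϑ z.1 z.2).gr i) (Ioo 0 T₁ ×ˢ univ)) ∧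
    (∀ i, ContinuousOn (fun z : ℝ × UnitAddTorus (Fin 3) =>
        (classicalPointData (Ico 0 T₁) ρ u ϑ z.1 z.2).gΘ i) (Ioo 0 T₁ ×ˢ univ)) ∧
    (∀ i j, ContinuousOn (fun z : ℝ × UnitAddTorus (Fin 3) =>
        (classicalPointData (Ico 0 T₁) ρ u ϑ z.1 z.2).gU i j) (Ioo 0 T₁ ×ˢ univ)) := by
  have hS := uniqueDiffOn_Ico_time T₁
  refine ⟨h.smooth_density.continuousOn_uncurry_Ioo, h.smooth_temperature.continuousOn_uncurry_Ioo,
    (h.smooth_density.timeDerivWithin hS).continuousOn_uncurry_Ioo,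
    (h.smooth_temperature.timeDerivWithin hS).continuousOn_uncurry_Ioo,
    fun i => (h.smooth_velocity.apply i).continuousOn_uncurry_Ioo,
    fun i => ((h.smooth_velocity.timeDerivWithin hS).apply i).continuousOn_uncurry_Ioo,
    fun i => ((h.smooth_density.gradient hS).apply i).continuousOn_uncurry_Ioo,
    fun i => ((h.smooth_temperature.gradient hS).apply i).continuousOn_uncurry_Ioo,
    fun i j => ((h.smooth_velocity.apply i).partialDeriv hS j).continuousOn_uncurry_Ioo⟩

/-- Along the solution, `(r, Θ)` stays in the open quadrant on `(0,T₁) × 𝕋³`. [folklore] -/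
theorem IsClassicalEulerSolution.mapsTo_thermo (h : IsClassicalEulerSolution eos T₁ ρ u ϑ) :
    MapsTo (fun z : ℝ × UnitAddTorus (Fin 3) =>
      ((classicalPointData (Ico 0 T₁) ρ u ϑ z.1 z.2).r, (classicalPointData (Ico 0 T₁) ρ u ϑ z.1 z.2).Θ))
      (Ioo 0 T₁ ×ˢ univ) (Ioi 0 ×ˢ Ioi 0) := fun z hz =>
  ⟨h.density_pos z.1 (Ioo_subset_Ico_self (mem_prod.1 hz).1) z.2,
    h.temperature_pos z.1 (Ioo_subset_Ico_self (mem_prod.1 hz).1) z.2⟩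

/-- **Continuity of the derived coefficients** `p_ρ, p_ϑ, s(r,Θ), p(r,Θ), μ(r,Θ)` of the point data
on `(0,T₁) × 𝕋³` (Gibbs' `C¹` regularity, through the continuous `(r,Θ)`). [folklore] -/
theorem IsClassicalEulerSolution.continuousOn_pointData_thermo (h : IsClassicalEulerSolution eos T₁ ρ u ϑ)
    (hG : eos.IsGibbs) :
    ContinuousOn (fun z : ℝ × UnitAddTorus (Fin 3) => (classicalPointData (Ico 0 T₁) ρ u ϑ z.1 z.2).pρ eos)
        (Ioo 0 T₁ ×ˢ univ) ∧
    ContinuousOn (fun z : ℝ × UnitAddTorus (Fin 3) => (classicalPointData (Ico 0 T₁) ρ u ϑ z.1 z.2).pϑ eos)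
        (Ioo 0 T₁ ×ˢ univ) ∧
    ContinuousOn (fun z : ℝ × UnitAddTorus (Fin 3) =>
        eos.s (classicalPointData (Ico 0 T₁) ρ u ϑ z.1 z.2).r (classicalPointData (Ico 0 T₁) ρ u ϑ z.1 z.2).Θ)
        (Ioo 0 T₁ ×ˢ univ) ∧
    ContinuousOn (fun z : ℝ × UnitAddTorus (Fin 3) =>
        eos.p (classicalPointData (Ico 0 T₁) ρ u ϑ z.1 z.2).r (classicalPointData (Ico 0 T₁) ρ u ϑ z.1 z.2).Θ)
        (Ioo 0 T₁ ×ˢ univ) ∧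
    ContinuousOn (fun z : ℝ × UnitAddTorus (Fin 3) =>
        eos.chemPotential (classicalPointData (Ico 0 T₁) ρ u ϑ z.1 z.2).r
          (classicalPointData (Ico 0 T₁) ρ u ϑ z.1 z.2).Θ) (Ioo 0 T₁ ×ˢ univ) := by
  obtain ⟨cr, cΘ, -⟩ := h.continuousOn_pointData_base
  have hpair := cr.prodMk cΘ
  have hmaps := h.mapsTo_thermo
  refine ⟨(continuousOn_deriv_slice_fst hG.1 isOpen_quadrant le_rfl).comp hpair hmaps,
    (continuousOn_deriv_slice_snd hG.1 isOpen_quadrant le_rfl).comp hpair hmaps,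
    hG.2.2.1.continuousOn.comp hpair hmaps, hG.1.continuousOn.comp hpair hmaps,
    hG.continuousOn_chemPotential.comp hpair hmaps⟩

end PointData

/-! ## Measurable modification and integrability of averages -/

section Modify

variable {α : Type*} [MeasurableSpace α]

/-- The kernel-integrability lemma `integrable_kernel_integral` for integrands that are only
controlled on the open quadrant: if `g x w = g̃ x w` and `|g x w| ≤ A·momentFun w + B` for `w` in
the quadrant, `g̃` is jointly measurable, `Φ̃` is a measurable modification of the moment function,
and the kernel is carried by the quadrant with `∫⁻∫⁻ momentFun < ∞`, then `g x` is integrable for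
a.e. `x`, `x ↦ ∫ g x dκ x` is integrable, with the natural `L¹` bound. [folklore] -/
theorem integrable_avg_of_dominated {μ : Measure α} [IsFiniteMeasure μ] {κ : Kernel α EulerPhase}
    [IsMarkovKernel κ] (hκ : ∀ x, ∀ᵐ w ∂κ x, w ∈ phaseQuadrant) {ceos : ConservativeEOS}
    {g g' : α → EulerPhase → ℝ} (hg' : Measurable (uncurry g'))
    (hgg : ∀ᵐ x ∂μ, ∀ w ∈ phaseQuadrant, g x w = g' x w)
    {Φ' : EulerPhase → ℝ} (hΦ' : Measurable Φ') (hΦ : ∀ w ∈ phaseQuadrant, Φ' w = momentFun ceos w)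
    {A B : ℝ} (hA : 0 ≤ A) (hB : 0 ≤ B)
    (hdom : ∀ᵐ x ∂μ, ∀ w ∈ phaseQuadrant, |g x w| ≤ A * momentFun ceos w + B)
    (hC : ∫⁻ x, ∫⁻ w, ENNReal.ofReal (momentFun ceos w) ∂κ x ∂μ ≠ ∞) :
    (∀ᵐ x ∂μ, Integrable (g x) (κ x)) ∧ Integrable (fun x => ∫ w, g x w ∂κ x) μ ∧
      ∫⁻ x, ‖∫ w, g x w ∂κ x‖ₑ ∂μ ≤
        ENNReal.ofReal A * ∫⁻ x, ∫⁻ w, ENNReal.ofReal (momentFun ceos w) ∂κ x ∂μ +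
          ENNReal.ofReal B * μ univ := by
  -- moment with the measurable modification
  have hΦint : ∀ x, ∫⁻ w, ENNReal.ofReal (Φ' w) ∂κ x = ∫⁻ w, ENNReal.ofReal (momentFun ceos w) ∂κ x := by
    intro x
    refine lintegral_congr_ae ?_
    filter_upwards [hκ x] with w hw
    rw [hΦ w hw]
  have hC' : ∫⁻ x, ∫⁻ w, ENNReal.ofReal (Φ' w) ∂κ x ∂μ ≠ ∞ := by
    rw [lintegral_congr fun x => hΦint x]; exact hC
  -- domination of `g'`
  have hbound : ∀ᵐ x ∂μ, ∀ᵐ w ∂κ x,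
      ‖g' x w‖ₑ ≤ ENNReal.ofReal A * ENNReal.ofReal (Φ' w) + ENNReal.ofReal B := by
    filter_upwards [hgg, hdom] with x hx hx'
    filter_upwards [hκ x] with w hw
    rw [← hx w hw, hΦ w hw, Real.enorm_eq_ofReal_abs, ← ENNReal.ofReal_mul hA,
      ← ENNReal.ofReal_add (by have := momentFun_nonneg (ceos := ceos) hw; positivity) hB]
    exact ENNReal.ofReal_le_ofReal (hx' w hw)
  obtain ⟨h1, h2, h3⟩ := integrable_kernel_integral (μ := μ) (κ := κ) hg' (hΦ'.ennreal_ofReal)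
    ENNReal.ofReal_ne_top ENNReal.ofReal_ne_top hbound hC'
  -- transfer back to `g`
  have hae : ∀ᵐ x ∂μ, g x =ᵐ[κ x] g' x := by
    filter_upwards [hgg] with x hx
    filter_upwards [hκ x] with w hw
    exact hx w hw
  have hint : ∀ᵐ x ∂μ, ∫ w, g x w ∂κ x = ∫ w, g' x w ∂κ x := by
    filter_upwards [hae] with x hx
    exact integral_congr_ae hx
  refine ⟨?_, ?_, ?_⟩
  · filter_upwards [h1, hae] with x hx hx'
    exact hx.congr hx'.symm
  · exact h2.congr (Filter.EventuallyEq.symm hint)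
  · rw [lintegral_congr_ae (hint.mono fun x hx => by rw [hx]), lintegral_congr fun x => (hΦint x).symm]
    exact h3

end Modify

/-! ## Joint continuity of the integrands on `((0,T₁) × 𝕋³) × quadrant` -/

section Integrands

variable {eos : EulerEOS} {T₁ : ℝ} {ρ : ℝ → UnitAddTorus (Fin 3) → ℝ}
  {u : ℝ → UnitAddTorus (Fin 3) → EuclideanSpace ℝ (Fin 3)} {ϑ : ℝ → UnitAddTorus (Fin 3) → ℝ}

/-- The point data of the solution at the space–time point `z = (t, x)`. [folklore] -/
abbrev pdAt (T₁ : ℝ) (ρ : ℝ → UnitAddTorus (Fin 3) → ℝ)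
    (u : ℝ → UnitAddTorus (Fin 3) → EuclideanSpace ℝ (Fin 3)) (ϑ : ℝ → UnitAddTorus (Fin 3) → ℝ)
    (z : ℝ × UnitAddTorus (Fin 3)) : StrongPointData :=
  classicalPointData (Ico 0 T₁) ρ u ϑ z.1 z.2

/-- The set `((0,T₁) × 𝕋³) × {ρ, E > 0}` on which all integrands are continuous. [folklore] -/
def goodSet (T₁ : ℝ) : Set ((ℝ × UnitAddTorus (Fin 3)) × EulerPhase) :=
  (Ioo 0 T₁ ×ˢ univ) ×ˢ phaseQuadrant

/-- The good set is measurable. [folklore] -/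
theorem measurableSet_goodSet (T₁ : ℝ) : MeasurableSet (goodSet T₁) :=
  ((measurableSet_Ioo.prod MeasurableSet.univ).prod measurableSet_phaseQuadrant)

section Lifts

variable {c : ℝ × UnitAddTorus (Fin 3) → ℝ} {a : EulerPhase → ℝ}

/-- Lift a function of `z` continuous on `(0,T₁) × 𝕋³` to the good set. [folklore] -/
theorem liftZ (hc : ContinuousOn c (Ioo 0 T₁ ×ˢ univ)) :
    ContinuousOn (fun q : (ℝ × UnitAddTorus (Fin 3)) × EulerPhase => c q.1) (goodSet T₁) :=
  hc.comp continuousOn_fst fun _ hq => hq.1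

/-- Lift a function of `w` continuous on the quadrant to the good set. [folklore] -/
theorem liftW (ha : ContinuousOn a phaseQuadrant) :
    ContinuousOn (fun q : (ℝ × UnitAddTorus (Fin 3)) × EulerPhase => a q.2) (goodSet T₁) :=
  ha.comp continuousOn_snd fun _ hq => hq.2

end Lifts

/-- Continuity of the derived coefficients `∂ₜφ₁, ∂ⱼφ₁, ∂ₜp, divU` of the point data on
`(0,T₁) × 𝕋³`. [folklore] -/
theorem IsClassicalEulerSolution.continuousOn_coeffs (h : IsClassicalEulerSolution eos T₁ ρ u ϑ)
    (hG : eos.IsGibbs) :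
    ContinuousOn (fun z => (pdAt T₁ ρ u ϑ z).φ₁t eos) (Ioo 0 T₁ ×ˢ univ) ∧
    (∀ j, ContinuousOn (fun z => (pdAt T₁ ρ u ϑ z).gφ₁ eos j) (Ioo 0 T₁ ×ˢ univ)) ∧
    ContinuousOn (fun z => (pdAt T₁ ρ u ϑ z).pt eos) (Ioo 0 T₁ ×ˢ univ) ∧
    ContinuousOn (fun z => (pdAt T₁ ρ u ϑ z).divU) (Ioo 0 T₁ ×ˢ univ) := by
  obtain ⟨cr, cΘ, crt, cΘt, cU, cUt, cgr, cgΘ, cgU⟩ := h.continuousOn_pointData_base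
  obtain ⟨cpρ, cpϑ, cs, -, -⟩ := h.continuousOn_pointData_thermo hG
  have hr0 : ∀ z ∈ Ioo (0 : ℝ) T₁ ×ˢ (univ : Set (UnitAddTorus (Fin 3))), (pdAt T₁ ρ u ϑ z).r ≠ 0 :=
    fun z hz => (h.density_pos z.1 (Ioo_subset_Ico_self (mem_prod.1 hz).1) z.2).ne'
  have cμρ : ContinuousOn (fun z => (pdAt T₁ ρ u ϑ z).μρ eos) (Ioo 0 T₁ ×ˢ univ) := cpρ.div cr hr0
  have cμϑ : ContinuousOn (fun z => (pdAt T₁ ρ u ϑ z).μϑ eos) (Ioo 0 T₁ ×ˢ univ) :=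
    cs.neg.add (cpϑ.div cr hr0)
  refine ⟨?_, fun j => ?_, ?_, ?_⟩
  · simp only [φ₁t]
    exact (continuousOn_finsetSum _ fun i _ => (cU i).mul (cUt i)).sub
      ((cμρ.mul crt).add (cμϑ.mul cΘt))
  · simp only [gφ₁]
    exact (continuousOn_finsetSum _ fun i _ => (cU i).mul (cgU i j)).sub
      ((cμρ.mul (cgr j)).add (cμϑ.mul (cgΘ j)))
  · simp only [pt]
    exact (cpρ.mul crt).add (cpϑ.mul cΘt)
  · simp only [divU]
    exact continuousOn_finsetSum _ fun i _ => cgU i i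

/-- **Joint continuity of the integrands** `contI`, `momI`, `entI Z` (continuous `Z`),
`relEnergyZ Z`, `∂ₜp`, `rawRHS Z`, `relEnergyFull` and `momentFun` on `((0,T₁) × 𝕋³) × quadrant`.
[folklore] -/
theorem IsClassicalEulerSolution.continuousOn_integrands (h : IsClassicalEulerSolution eos T₁ ρ u ϑ)
    (hG : eos.IsGibbs) (hS : eos.IsThermodynamicallyStable)
    (htemp : ∀ r E : ℝ, 0 < r → 0 < E →
      0 < eos.temperature r E ∧ r * eos.e r (eos.temperature r E) = E)
    {Z : ℝ → ℝ} (hZ : Continuous Z) :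
    ContinuousOn (fun q => (pdAt T₁ ρ u ϑ q.1).contI eos q.2) (goodSet T₁) ∧
    ContinuousOn (fun q => (pdAt T₁ ρ u ϑ q.1).momI eos q.2) (goodSet T₁) ∧
    ContinuousOn (fun q => (pdAt T₁ ρ u ϑ q.1).entI eos Z q.2) (goodSet T₁) ∧
    ContinuousOn (fun q => (pdAt T₁ ρ u ϑ q.1).relEnergyZ eos Z q.2) (goodSet T₁) ∧
    ContinuousOn (fun q => rawRHS eos Z (pdAt T₁ ρ u ϑ q.1) (dens q.2) (ien q.2) (mom q.2)) (goodSet T₁) ∧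
    ContinuousOn (fun q => relEnergyFull eos (pdAt T₁ ρ u ϑ q.1) (dens q.2) (ien q.2) (mom q.2))
      (goodSet T₁) ∧
    ContinuousOn (fun q : (ℝ × UnitAddTorus (Fin 3)) × EulerPhase => momentFun eos.toConservative q.2)
      (goodSet T₁) := by
  obtain ⟨cr, cΘ, crt, cΘt, cU, cUt, cgr, cgΘ, cgU⟩ := h.continuousOn_pointData_base
  obtain ⟨cpρ, cpϑ, cs, cp, cμ⟩ := h.continuousOn_pointData_thermo hG
  obtain ⟨cφ₁t, cgφ₁, cpt, cdivU⟩ := h.continuousOn_coeffs hG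
  have wT := continuousOn_stateTemp hG hS htemp
  have wP := continuousOn_statePressure hG hS htemp
  have wS := continuousOn_stateEntropy hG hS htemp
  have wK := continuousOn_kineticEnergy
  have wD : Continuous (dens : EulerPhase → ℝ) := continuous_dens
  have wE : Continuous (ien : EulerPhase → ℝ) := continuous_ien
  have wM : ∀ i, Continuous fun w : EulerPhase => mom w i := fun i =>
    (EuclideanSpace.proj i : EuclideanSpace ℝ (Fin 3) →L[ℝ] ℝ).continuous.comp continuous_mom
  have wZS : ContinuousOn (fun w : EulerPhase => Z (eos.s (dens w) (stateTemp eos (dens w) (ien w))))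
      phaseQuadrant := hZ.comp_continuousOn wS
  have hρ0 : ∀ q ∈ goodSet T₁, dens q.2 ≠ 0 := fun q hq => (hq.2.1).ne'
  -- contI
  have hcont : ContinuousOn (fun q => (pdAt T₁ ρ u ϑ q.1).contI eos q.2) (goodSet T₁) := by
    simp only [contI]
    exact ((liftW wD.continuousOn).mul (liftZ cφ₁t)).add
      (continuousOn_finsetSum _ fun i _ => (liftW (wM i).continuousOn).mul (liftZ (cgφ₁ i)))
  -- momI
  have hmom : ContinuousOn (fun q => (pdAt T₁ ρ u ϑ q.1).momI eos q.2) (goodSet T₁) := by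
    simp only [momI]
    refine ((continuousOn_finsetSum _ fun i _ => (liftW (wM i).continuousOn).mul (liftZ (cUt i))).add
      (continuousOn_finsetSum _ fun i _ => continuousOn_finsetSum _ fun j _ => ?_)).add
      ((liftW wP).mul (liftZ cdivU))
    exact ((((liftW (wM i).continuousOn).mul (liftW (wM j).continuousOn)).div (liftW wD.continuousOn)
      hρ0).mul (liftZ (cgU i j)))
  -- entI
  have hent : ContinuousOn (fun q => (pdAt T₁ ρ u ϑ q.1).entI eos Z q.2) (goodSet T₁) := by
    simp only [entI]
    exact (((liftW wD.continuousOn).mul (liftW wZS)).mul (liftZ cΘt)).add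
      (continuousOn_finsetSum _ fun i _ => ((liftW wZS).mul (liftW (wM i).continuousOn)).mul (liftZ (cgΘ i)))
  -- relEnergyZ
  have hU : ContinuousOn (fun z : ℝ × UnitAddTorus (Fin 3) => (pdAt T₁ ρ u ϑ z).U) (Ioo 0 T₁ ×ˢ univ) :=
    h.smooth_velocity.continuousOn_uncurry_Ioo
  have hrelZ : ContinuousOn (fun q => (pdAt T₁ ρ u ϑ q.1).relEnergyZ eos Z q.2) (goodSet T₁) := by
    simp only [relEnergyZ]
    refine (((((liftW wK).add (liftW wE.continuousOn)).sub
      (continuousOn_finsetSum _ fun i _ => (liftW (wM i).continuousOn).mul (liftZ (cU i)))).add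
      ((liftW wD.continuousOn).mul (liftZ (((hU.norm.pow 2).div_const 2).sub cμ)))).sub
      ((liftZ cΘ).mul ((liftW wD.continuousOn).mul (liftW wZS)))).add (liftZ cp)
  -- rawRHS
  have hraw : ContinuousOn (fun q => rawRHS eos Z (pdAt T₁ ρ u ϑ q.1) (dens q.2) (ien q.2) (mom q.2))
      (goodSet T₁) := by
    have : (fun q : (ℝ × UnitAddTorus (Fin 3)) × EulerPhase =>
        rawRHS eos Z (pdAt T₁ ρ u ϑ q.1) (dens q.2) (ien q.2) (mom q.2)) =
        fun q => -(pdAt T₁ ρ u ϑ q.1).momI eos q.2 + (pdAt T₁ ρ u ϑ q.1).contI eos q.2 -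
          (pdAt T₁ ρ u ϑ q.1).entI eos Z q.2 + (pdAt T₁ ρ u ϑ q.1).pt eos := by
      funext q; exact rawRHS_eq_pieces Z _ q.2
    rw [this]
    exact ((hmom.neg.add hcont).sub hent).add (liftZ cpt)
  -- relEnergyFull
  have hfull : ContinuousOn (fun q => relEnergyFull eos (pdAt T₁ ρ u ϑ q.1) (dens q.2) (ien q.2) (mom q.2))
      (goodSet T₁) := by
    have wPair := continuousOn_dens_stateTemp hG hS htemp
    have we : ContinuousOn (fun w : EulerPhase => eos.e (dens w) (stateTemp eos (dens w) (ien w)))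
        phaseQuadrant := hG.2.1.continuousOn.comp wPair.1 wPair.2
    have hpair := cr.prodMk cΘ
    have hmaps := h.mapsTo_thermo
    have he' : ContinuousOn (fun z => eos.e (pdAt T₁ ρ u ϑ z).r (pdAt T₁ ρ u ϑ z).Θ)
        (Ioo 0 T₁ ×ˢ univ) := hG.2.1.continuousOn.comp hpair hmaps
    have hA : ContinuousOn (fun q : (ℝ × UnitAddTorus (Fin 3)) × EulerPhase =>
        (∑ i, (mom q.2 i - dens q.2 * (pdAt T₁ ρ u ϑ q.1).U i) ^ 2) / (2 * dens q.2)) (goodSet T₁) :=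
      (continuousOn_finsetSum _ fun i _ =>
        ((liftW (wM i).continuousOn).sub ((liftW wD.continuousOn).mul (liftZ (cU i)))).pow 2).div
        (continuousOn_const.mul (liftW wD.continuousOn)) fun q hq => mul_ne_zero two_ne_zero (hq.2.1).ne'
    have hB : ContinuousOn (fun q : (ℝ × UnitAddTorus (Fin 3)) × EulerPhase =>
        dens q.2 * eos.e (dens q.2) (stateTemp eos (dens q.2) (ien q.2)) -
          (pdAt T₁ ρ u ϑ q.1).Θ * (dens q.2 * eos.s (dens q.2) (stateTemp eos (dens q.2) (ien q.2))))
        (goodSet T₁) :=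
      ((liftW wD.continuousOn).mul (liftW we)).sub
        ((liftZ cΘ).mul ((liftW wD.continuousOn).mul (liftW wS)))
    have hC : ContinuousOn (fun q : (ℝ × UnitAddTorus (Fin 3)) × EulerPhase =>
        eos.chemPotential (pdAt T₁ ρ u ϑ q.1).r (pdAt T₁ ρ u ϑ q.1).Θ * (dens q.2 - (pdAt T₁ ρ u ϑ q.1).r))
        (goodSet T₁) := (liftZ cμ).mul ((liftW wD.continuousOn).sub (liftZ cr))
    have hD : ContinuousOn (fun q : (ℝ × UnitAddTorus (Fin 3)) × EulerPhase =>
        (pdAt T₁ ρ u ϑ q.1).r * eos.e (pdAt T₁ ρ u ϑ q.1).r (pdAt T₁ ρ u ϑ q.1).Θ -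
          (pdAt T₁ ρ u ϑ q.1).Θ * ((pdAt T₁ ρ u ϑ q.1).r * eos.s (pdAt T₁ ρ u ϑ q.1).r (pdAt T₁ ρ u ϑ q.1).Θ))
        (goodSet T₁) := liftZ ((cr.mul he').sub (cΘ.mul (cr.mul cs)))
    simp only [relEnergyFull, relEnergyThermo, ballisticFreeEnergy]
    exact hA.add ((hB.sub hC).sub hD)
  exact ⟨hcont, hmom, hent, hrelZ, hraw, hfull, (liftW (continuousOn_momentFun hG hS htemp))⟩

/-- **Measurable modification**: a function continuous on the good set, extended by `0`, is
jointly measurable. [folklore] -/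
theorem measurable_modify {g : (ℝ × UnitAddTorus (Fin 3)) × EulerPhase → ℝ}
    (hg : ContinuousOn g (goodSet T₁)) [∀ q, Decidable (q ∈ goodSet T₁)] :
    Measurable ((goodSet T₁).piecewise g 0) :=
  measurable_piecewise_zero hg (measurableSet_goodSet T₁)

end Integrands

end CompressibleEuler

end Literature.Analysis.FluidPDE
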